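import Mathlib
import HarnessLib
import Summits.HubbardSuperconductivity.HubbardSuperconductivity.Theorems.KLProgrammeKLRegimeSplitTwoLegReadingSlopesFn

/-!
# Route `KLProgramme` — K3's ENGINE child (19855 and its gen-5 twin), two-leg stubs: the (E3c) CLOSER on the de-interpolated carrier —
# `FrameLipschitzFn`'s two-frame bound for the pieces `ℓ_n(K)` from the engine's frame RESPONSE at fixed momenta + ONE gradient bound per scale

Cell `gate-hubbard-kl`, seat p1b (g6); continues `…TwoLegReadingSlopesFn` (p481630) and TWO-LEG-CLOSERS.md §1 row (E3c).  The two-leg slot's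
(E3c) clause (`FrameLipschitzFn`, `…SplitFrameFn` §4) asks `|ℓ_n(K)(q) − ℓ_n(K′)(q)| ≤ lipBar n · frameDistFn K K′` for every admissible comparison
frame `K′`.  With de-interpolated pieces (Δ23 ruling; identical text under (R-I) and (R-I-min), `K : TrigPolyC4v` entering as `K.eval`):
`ℓ_n(K) = E_μ(ν_n^K) − E_μ(ν_{n−1}^K)` (`n ≥ 1`), `ℓ_0(K) = E_μ(ν_0^K) − E_μ(K ∘ k_F^K)`, `E_μ = klFrameExtFn μ`, `ν_m^K(θ) = S_m^K(k_F^K(θ))`,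
`S_m^K = symInterp L (klLocSelfEnergyRe … (toTrigPoly L K) m)`.  This file reduces the clause to THREE inputs per scale:

* §1 **`E_μ` is 1-Lipschitz in the profile (sup norms)**: `|E_μ(f)(p) − E_μ(g)(p)| ≤ sup_θ|f − g|` for interval-integrable profiles
  (`abs_klFrameExtFn_sub_klFrameExtFn_le`: `E_μ(f) − E_μ(g) = (1 − χ)(mean f − mean g) + χ·(f − g)(angle)`, `χ ∈ [0,1]`);
* §2 **profiles on two frames**: `sup_θ |ν^K_S(θ) − ν^{K′}_{S′}(θ)| ≤ r + b·frameDistFn K K′/(Dt_min − A₁)` where `r` bounds the engine's RESPONSE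
  `|S(k_F^{K′}θ) − S′(k_F^{K′}θ)|` at the comparison frame's reading points and `b` the gradient of `S` (`…ReadingSlopesFn`'s split); for the frame
  read on its own curve (the `n = 0` normal form) NO engine input: `sup_θ |K(k_F^K θ) − K′(k_F^{K′} θ)| ≤ (1 + A₁/(Dt_min − A₁))·frameDistFn K K′`;
* §3 **the pieces**: `|ℓ_{n+1}(K)(q) − ℓ_{n+1}(K′)(q)| ≤ (r_{n+1} + r_n) + (b_{n+1} + b_n)·frameDistFn/(Dt_min − A₁)`
  (`abs_klTwoLegPieceFn_succ_sub_le`) and `|ℓ_0(K)(q) − ℓ_0(K′)(q)| ≤ r_0 + (b_0 + Dt_min)·frameDistFn/(Dt_min − A₁)` (`abs_klTwoLegPieceFn_zero_sub_le`).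

So the engine owes for (E3c) exactly: (M3) the response numbers `r_m ≤ tlLip m · frameDistFn K K′` (a two-leg-vertex insertion of the expansion at
fixed external momentum) and (M1, j = 1) the gradient bounds `b_m = coeffNorm 1 S_m` — and the fit `(tlLip_{n}+tlLip_{n−1}) + (b_n + b_{n−1})/(Dt_min − A₁)
≤ lipBar n`.  Frame hypotheses are primitive (`IsSymmetricFrame`, `Differentiable (onM ·)`, `|·| ≤ A₀`, `‖D(onM K)‖ ≤ A₁ < Dt_min`, window); the
profiles' interval-integrability on `[0, 2π]` is a hypothesis (continuity of `k_F^K`, e.g. `contDiff_klFermiPoint`).  Everything is PROVED; no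
definitions; nothing about the model is asserted.  References: BGM 2006 §2.4 Lemma 2.1 (2.40) [cite: BenfattoGiulianiMastropietro2006]; FST IV §1.
-/

noncomputable section

namespace Summit.HubbardSuperconductivity.HubbardSuperconductivity.Theorems.KLRegimeSplit

set_option linter.dupNamespace false -- summit = problem name (single-conjunct summit), D-0017

open Real Set MeasureTheory
open Literature.MathematicalPhysics.QuantumLattice Literature.MathematicalPhysics.QuantumLattice.BandSectorCounting
open Literature.Probability.LatticeModels
open Summit.HubbardSuperconductivity.HubbardSuperconductivity.Theorems.DispersionFlow
open Summit.HubbardSuperconductivity.HubbardSuperconductivity.Theorems.PerturbedFermiCurve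
open Summit.HubbardSuperconductivity.HubbardSuperconductivity.Theorems.KLProgrammeLegKernels

/-! ## §1 The de-interpolated G-extension is 1-Lipschitz in the profile -/

/-- **`E_μ` is 1-Lipschitz in the profile (sup norms)**: for interval-integrable profiles with `|f − g| ≤ ε` everywhere,
`|klFrameExtFn μ f p − klFrameExtFn μ g p| ≤ ε` at every momentum — `E_μ(f) − E_μ(g) = (1 − χ)(mean f − mean g) + χ·(f − g)(angle p̃)` with
`χ = klFlatCutoffFn μ p ∈ [0, 1]` and `|mean f − mean g| ≤ ε`. -/
theorem abs_klFrameExtFn_sub_klFrameExtFn_le (μ : ℝ) {f g : ℝ → ℝ} (hf : IntervalIntegrable f volume 0 (2 * π))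
    (hg : IntervalIntegrable g volume 0 (2 * π)) {ε : ℝ} (h : ∀ θ, |f θ - g θ| ≤ ε) (p : Fin 2 → ℝ) :
    |klFrameExtFn μ f p - klFrameExtFn μ g p| ≤ ε := by
  have hm : |klAngularMean f - klAngularMean g| ≤ ε := abs_klAngularMean_sub_le hf hg fun θ _ => h θ
  have hχ := klFlatCutoffFn_mem_Icc μ p
  set χ := klFlatCutoffFn μ p with hχdef
  set a := polarAngle (centredRep p) with ha
  have hid : klFrameExtFn μ f p - klFrameExtFn μ g p =
      (1 - χ) * (klAngularMean f - klAngularMean g) + χ * (f a - g a) := by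
    simp only [klFrameExtFn, ← hχdef, ← ha]; ring
  rw [hid]
  have h1 : |(1 - χ) * (klAngularMean f - klAngularMean g)| ≤ (1 - χ) * ε := by
    rw [abs_mul, abs_of_nonneg (sub_nonneg.2 hχ.2)]
    exact mul_le_mul_of_nonneg_left hm (sub_nonneg.2 hχ.2)
  have h2 : |χ * (f a - g a)| ≤ χ * ε := by
    rw [abs_mul, abs_of_nonneg hχ.1]
    exact mul_le_mul_of_nonneg_left (h a) hχ.1
  calc _ ≤ |(1 - χ) * (klAngularMean f - klAngularMean g)| + |χ * (f a - g a)| := abs_add_le _ _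
    _ ≤ (1 - χ) * ε + χ * ε := add_le_add h1 h2
    _ = ε := by ring

/-! ## §2 Profiles on two frames -/

section TwoFrames

variable {a b : ℝ} (B : BandBounds a b) {K K' : FrameFn} {A₀ A₁ : ℝ}
  (hKs : IsSymmetricFrame K) (hKs' : IsSymmetricFrame K')
  (hKd : Differentiable ℝ (onM K)) (hKd' : Differentiable ℝ (onM K'))
  (hK0 : ∀ p : Fin 2 → ℝ, |K p| ≤ A₀) (hK0' : ∀ p : Fin 2 → ℝ, |K' p| ≤ A₀)
  (hK1 : ∀ q : Momentum, ‖fderiv ℝ (onM K) q‖ ≤ A₁) (hA₁ : A₁ < B.Dtmin)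
  {μ : ℝ} (hlo : a ≤ μ - A₀) (hhi : μ + A₀ ≤ b)
include B hKs hKs' hKd hKd' hK0 hK0' hK1 hA₁ hlo hhi

/-- **The local-part profiles of two frames differ by response + gradient × frame distance**: for reading functions `S, S′ : TrigPolyC4v` with
`‖D(evalM S)‖ ≤ b` on `Momentum` (`b ≥ 0`) and the RESPONSE bound `|S(k_F^{K′}θ) − S′(k_F^{K′}θ)| ≤ r` at the comparison frame's reading points,
`|S(k_F^K θ) − S′(k_F^{K′} θ)| ≤ r + b·frameDistFn K K′/(Dt_min − A₁)` for every `θ`. -/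
theorem abs_eval_klFermiPointFn_sub_le_of_response (S S' : TrigPolyC4v) {bS r : ℝ} (hbS : 0 ≤ bS)
    (hgrad : ∀ q : Momentum, ‖fderiv ℝ (evalM S) q‖ ≤ bS)
    (hresp : ∀ θ : ℝ, |S.eval (klFermiPointFn μ K' θ) - S'.eval (klFermiPointFn μ K' θ)| ≤ r) (θ : ℝ) :
    |S.eval (klFermiPointFn μ K θ) - S'.eval (klFermiPointFn μ K' θ)| ≤ r + bS * (frameDistFn K K' / (B.Dtmin - A₁)) := by
  have h := abs_apply_klFermiPointFn_sub_le_of_frames B hKs hKs' hKd hKd' hK0 hK0' hK1 hA₁ hlo hhi (fun p => S.eval p)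
    (fun p => S'.eval p) hbS (radialLipschitz_eval_of_norm_fderiv_evalM_le S hgrad θ) (θ := θ)
  have h2 := hresp θ
  beta_reduce at h
  linarith

/-- **The frame read on its own curve, two frames, NO engine input**: `|K(k_F^K θ) − K′(k_F^{K′} θ)| ≤ frameDistFn K K′ + A₁·frameDistFn K K′/(Dt_min − A₁)`
(the normal form's profile; `K` itself is the reading function, radially `A₁`-Lipschitz). -/
theorem abs_frameOnCurveFn_sub_le (θ : ℝ) :
    |K (klFermiPointFn μ K θ) - K' (klFermiPointFn μ K' θ)| ≤
      frameDistFn K K' + A₁ * (frameDistFn K K' / (B.Dtmin - A₁)) := by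
  have hA₁0 : 0 ≤ A₁ := (norm_nonneg _).trans (hK1 0)
  have hbdd := bddAbove_range_abs_sub hKs (continuous_of_differentiable_onM hKd) hKs' (continuous_of_differentiable_onM hKd')
  have h := abs_apply_klFermiPointFn_sub_le_of_frames B hKs hKs' hKd hKd' hK0 hK0' hK1 hA₁ hlo hhi K K' hA₁0
    (radialLipschitz_of_norm_fderiv_onM_le hKd hK1 θ) (θ := θ)
  exact h.trans (by linarith [abs_sub_le_frameDistFn hbdd (klFermiPointFn μ K' θ)])

/-! ## §3 The pieces -/

variable {L M : ℕ} [NeZero L] [NeZero M]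

/-- **(E3c) for the piece at scale `n + 1`, from responses and gradients at scales `n + 1` and `n`.**  With
`S_m^X := symInterp L (klLocSelfEnergyRe L M β U μ (toTrigPoly L X) m)`, gradient bounds `‖D(evalM S_m^K)‖ ≤ b_m` (`b_m ≥ 0`), response bounds
`|S_m^K(k_F^{K′}θ) − S_m^{K′}(k_F^{K′}θ)| ≤ r_m` for all `θ` (`m = n, n+1`), and the four local-part profiles interval-integrable on `[0, 2π]`:
`|ℓ_{n+1}(K)(q) − ℓ_{n+1}(K′)(q)| ≤ (r_{n+1} + r_n) + (b_{n+1} + b_n)·frameDistFn K K′/(Dt_min − A₁)` at every momentum `q`. -/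
theorem abs_klTwoLegPieceFn_succ_sub_le {β U : ℝ} {n : ℕ} {b₁ b₀ r₁ r₀ : ℝ} (hb₁ : 0 ≤ b₁) (hb₀ : 0 ≤ b₀)
    (hgrad₁ : ∀ q : Momentum, ‖fderiv ℝ (evalM (symInterp L (klLocSelfEnergyRe L M β U μ (toTrigPoly L K) (n + 1)))) q‖ ≤ b₁)
    (hgrad₀ : ∀ q : Momentum, ‖fderiv ℝ (evalM (symInterp L (klLocSelfEnergyRe L M β U μ (toTrigPoly L K) n))) q‖ ≤ b₀)
    (hresp₁ : ∀ θ : ℝ, |(symInterp L (klLocSelfEnergyRe L M β U μ (toTrigPoly L K) (n + 1))).eval (klFermiPointFn μ K' θ) -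
      (symInterp L (klLocSelfEnergyRe L M β U μ (toTrigPoly L K') (n + 1))).eval (klFermiPointFn μ K' θ)| ≤ r₁)
    (hresp₀ : ∀ θ : ℝ, |(symInterp L (klLocSelfEnergyRe L M β U μ (toTrigPoly L K) n)).eval (klFermiPointFn μ K' θ) -
      (symInterp L (klLocSelfEnergyRe L M β U μ (toTrigPoly L K') n)).eval (klFermiPointFn μ K' θ)| ≤ r₀)
    (hI₁ : IntervalIntegrable (klLocalPartFn L M β U μ K (n + 1)) volume 0 (2 * π))
    (hI₁' : IntervalIntegrable (klLocalPartFn L M β U μ K' (n + 1)) volume 0 (2 * π))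
    (hI₀ : IntervalIntegrable (klLocalPartFn L M β U μ K n) volume 0 (2 * π))
    (hI₀' : IntervalIntegrable (klLocalPartFn L M β U μ K' n) volume 0 (2 * π)) (q : Fin 2 → ℝ) :
    |klTwoLegPieceFn L M β U μ K (n + 1) q - klTwoLegPieceFn L M β U μ K' (n + 1) q| ≤
      (r₁ + r₀) + (b₁ + b₀) * (frameDistFn K K' / (B.Dtmin - A₁)) := by
  have h₁ : ∀ θ, |klLocalPartFn L M β U μ K (n + 1) θ - klLocalPartFn L M β U μ K' (n + 1) θ| ≤
      r₁ + b₁ * (frameDistFn K K' / (B.Dtmin - A₁)) := fun θ =>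
    abs_eval_klFermiPointFn_sub_le_of_response B hKs hKs' hKd hKd' hK0 hK0' hK1 hA₁ hlo hhi _ _ hb₁ hgrad₁ hresp₁ θ
  have h₀ : ∀ θ, |klLocalPartFn L M β U μ K n θ - klLocalPartFn L M β U μ K' n θ| ≤
      r₀ + b₀ * (frameDistFn K K' / (B.Dtmin - A₁)) := fun θ =>
    abs_eval_klFermiPointFn_sub_le_of_response B hKs hKs' hKd hKd' hK0 hK0' hK1 hA₁ hlo hhi _ _ hb₀ hgrad₀ hresp₀ θ
  have hE₁ := abs_klFrameExtFn_sub_klFrameExtFn_le μ hI₁ hI₁' h₁ q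
  have hE₀ := abs_klFrameExtFn_sub_klFrameExtFn_le μ hI₀ hI₀' h₀ q
  rw [klTwoLegPieceFn_succ, klTwoLegPieceFn_succ]
  simp only [Pi.sub_apply, klTwoLegPolyFn]
  calc |klFrameExtFn μ (klLocalPartFn L M β U μ K (n + 1)) q - klFrameExtFn μ (klLocalPartFn L M β U μ K n) q -
        (klFrameExtFn μ (klLocalPartFn L M β U μ K' (n + 1)) q - klFrameExtFn μ (klLocalPartFn L M β U μ K' n) q)|
      = |(klFrameExtFn μ (klLocalPartFn L M β U μ K (n + 1)) q - klFrameExtFn μ (klLocalPartFn L M β U μ K' (n + 1)) q) -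
          (klFrameExtFn μ (klLocalPartFn L M β U μ K n) q - klFrameExtFn μ (klLocalPartFn L M β U μ K' n) q)| := by ring_nf
    _ ≤ |klFrameExtFn μ (klLocalPartFn L M β U μ K (n + 1)) q - klFrameExtFn μ (klLocalPartFn L M β U μ K' (n + 1)) q| +
          |klFrameExtFn μ (klLocalPartFn L M β U μ K n) q - klFrameExtFn μ (klLocalPartFn L M β U μ K' n) q| := abs_sub _ _
    _ ≤ _ := by linarith

/-- **(E3c) for the piece at scale `0`, from the scale-`0` response and gradient** (the normal-form half needs no engine input).  With
`S_0^X := symInterp L (klLocSelfEnergyRe L M β U μ (toTrigPoly L X) 0)`, `‖D(evalM S_0^K)‖ ≤ b_0` (`b_0 ≥ 0`),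
`|S_0^K(k_F^{K′}θ) − S_0^{K′}(k_F^{K′}θ)| ≤ r_0`, and the four profiles (`ν_0^K`, `ν_0^{K′}`, `K ∘ k_F^K`, `K′ ∘ k_F^{K′}`) interval-integrable:
`|ℓ_0(K)(q) − ℓ_0(K′)(q)| ≤ r_0 + frameDistFn K K′ + (b_0 + A₁)·frameDistFn K K′/(Dt_min − A₁)`. -/
theorem abs_klTwoLegPieceFn_zero_sub_le {β U : ℝ} {b₀ r₀ : ℝ} (hb₀ : 0 ≤ b₀)
    (hgrad₀ : ∀ q : Momentum, ‖fderiv ℝ (evalM (symInterp L (klLocSelfEnergyRe L M β U μ (toTrigPoly L K) 0))) q‖ ≤ b₀)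
    (hresp₀ : ∀ θ : ℝ, |(symInterp L (klLocSelfEnergyRe L M β U μ (toTrigPoly L K) 0)).eval (klFermiPointFn μ K' θ) -
      (symInterp L (klLocSelfEnergyRe L M β U μ (toTrigPoly L K') 0)).eval (klFermiPointFn μ K' θ)| ≤ r₀)
    (hI₀ : IntervalIntegrable (klLocalPartFn L M β U μ K 0) volume 0 (2 * π))
    (hI₀' : IntervalIntegrable (klLocalPartFn L M β U μ K' 0) volume 0 (2 * π))
    (hIK : IntervalIntegrable (fun θ => K (klFermiPointFn μ K θ)) volume 0 (2 * π))
    (hIK' : IntervalIntegrable (fun θ => K' (klFermiPointFn μ K' θ)) volume 0 (2 * π)) (q : Fin 2 → ℝ) :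
    |klTwoLegPieceFn L M β U μ K 0 q - klTwoLegPieceFn L M β U μ K' 0 q| ≤
      r₀ + frameDistFn K K' + (b₀ + A₁) * (frameDistFn K K' / (B.Dtmin - A₁)) := by
  have h₀ : ∀ θ, |klLocalPartFn L M β U μ K 0 θ - klLocalPartFn L M β U μ K' 0 θ| ≤
      r₀ + b₀ * (frameDistFn K K' / (B.Dtmin - A₁)) := fun θ =>
    abs_eval_klFermiPointFn_sub_le_of_response B hKs hKs' hKd hKd' hK0 hK0' hK1 hA₁ hlo hhi _ _ hb₀ hgrad₀ hresp₀ θ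
  have hP : ∀ θ, |(fun θ => K (klFermiPointFn μ K θ)) θ - (fun θ => K' (klFermiPointFn μ K' θ)) θ| ≤
      frameDistFn K K' + A₁ * (frameDistFn K K' / (B.Dtmin - A₁)) := fun θ =>
    abs_frameOnCurveFn_sub_le B hKs hKs' hKd hKd' hK0 hK0' hK1 hA₁ hlo hhi θ
  have hE₀ := abs_klFrameExtFn_sub_klFrameExtFn_le μ hI₀ hI₀' h₀ q
  have hEP := abs_klFrameExtFn_sub_klFrameExtFn_le μ hIK hIK' hP q
  rw [klTwoLegPieceFn_zero, klTwoLegPieceFn_zero]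
  simp only [Pi.sub_apply, klTwoLegPolyFn, klFrameProjFn]
  calc |klFrameExtFn μ (klLocalPartFn L M β U μ K 0) q - klFrameExtFn μ (fun θ => K (klFermiPointFn μ K θ)) q -
        (klFrameExtFn μ (klLocalPartFn L M β U μ K' 0) q - klFrameExtFn μ (fun θ => K' (klFermiPointFn μ K' θ)) q)|
      = |(klFrameExtFn μ (klLocalPartFn L M β U μ K 0) q - klFrameExtFn μ (klLocalPartFn L M β U μ K' 0) q) -
          (klFrameExtFn μ (fun θ => K (klFermiPointFn μ K θ)) q - klFrameExtFn μ (fun θ => K' (klFermiPointFn μ K' θ)) q)| := by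
        ring_nf
    _ ≤ |klFrameExtFn μ (klLocalPartFn L M β U μ K 0) q - klFrameExtFn μ (klLocalPartFn L M β U μ K' 0) q| +
          |klFrameExtFn μ (fun θ => K (klFermiPointFn μ K θ)) q - klFrameExtFn μ (fun θ => K' (klFermiPointFn μ K' θ)) q| :=
        abs_sub _ _
    _ ≤ _ := by linarith

end TwoFrames

end Summit.HubbardSuperconductivity.HubbardSuperconductivity.Theorems.KLRegimeSplit

end
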